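import Literature.NumberTheory.LFunctions.RodgersTaoRenormEnergyExpansionProofs
import HarnessLib

/-!
# Rodgers–Tao 2020, §7, Lemma 18 (= arXiv v4 Lemma 7.3), PART I: the weighted inner sum
# `Σ_{k ∈ ℤ* : k ≠ j} ψ_T(k)/(ξ_k − ξ_j)³ ≲ 1/|j| + 1/T` (RH-FREE, `t`-free) and the weight `ψ_T`

Topic: NumberTheory/LFunctions (trunk T-ANT). Proofs only: 0 definitions, 0 named facts.
Companion of `Literature.NumberTheory.LFunctions.RodgersTaoHamiltonian` (which TYPES §7 of
B. Rodgers, T. Tao, *The de Bruijn–Newman constant is non-negative*, Forum Math. Pi 8 (2020) e6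
= arXiv:1801.05914, as printed; Lemma 18 = the named fact `rodgers_tao_truncEnergy_expansion`,
VACUOUS-AS-PRINTED, EX-FALSO record `rodgers_tao_truncEnergy_expansion_holds`) and sequel of
`RodgersTaoRenormEnergyExpansionProofs` (Lemma 16 twin + display (64), whose lattice
comparisons are reused here). Cell rh-crit C3, content-twin enrichment (rt-t3 g3, «L7.3-I»).

LINE 1 — LABEL. **RH-FREE CONTENT, `t`-FREE**: every statement in this file is about the
classical locations `ξ_j` (§3 (42)) and the weight `ψ_T` of (66) only — no `H_t`, no zeros, no
`Λ`. bears_on: N-C/N-P (COLUMN 3 DBN). WHAT THIS IS NOT: a weighted lattice-sum estimate inside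
Rodgers–Tao §7; not Lemma 18 itself (PART II, the time-translated schema twin with the printed
summability hypotheses, is a separate filing), not progress toward RH; nothing in this file bears
on the truth of the Riemann hypothesis.

## What the source prints (FMP pp. 42–43 = arXiv:1801.05914v5 §7, TeX l. 1059–1083)

> **Lemma 18.** For almost every `Λ/2 ≤ t ≤ 0`, one has
> `Ẽ_T(t) = (Σ_{j,k ∈ ℤ* : j ≠ k} ψ_T(j)ψ_T(k)(E_{jk}(t) − 1/|ξ_k − ξ_j|²)) + Õ(1)`.
> *Proof.* For almost every `t`, one sees from Proposition 15, (66), and Fubini's theorem (and (51))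
> that the series `Σ_{j ≠ k} ψ_T(j)ψ_T(k)(E_{jk}(t) + 1/|ξ_k − ξ_j|² + (|x_j(t)| + |x_k(t)|)/|ξ_k − ξ_j|³)`
> is absolutely convergent. Thus, by Fubini's theorem and (63), it will suffice to show that
> `Σ_{j,k ∈ ℤ* : j ≠ k} ψ_T(j)ψ_T(k)((x_k(t) − ξ_k) − (x_j(t) − ξ_j))/(ξ_k − ξ_j)³ ≲ 1`. We may
> desymmetrize the left-hand side (again using Fubini's theorem) as
> `2Σ_{j ∈ ℤ*} ψ_T(j)(x_j(t) − ξ_j)Σ_{k ∈ ℤ* : k ≠ j} ψ_T(k)/(ξ_k − ξ_j)³`, and so it will suffice to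
> establish the bound **`Σ_{k ∈ ℤ* : k ≠ j} ψ_T(k)/(ξ_k − ξ_j)³ ≲ 1/|j| + 1/T` for all `j ∈ ℤ*`.**
> As in the proof of Lemma 16, we see from (44) that the contribution of those `k` with
> `|k − j| ≥ j/2` is acceptable. For the remaining range `|k − j| < j/2`, we again use (45) to
> estimate `1/(ξ_k − ξ_j)³ = (log³ξ_j/(4π)³)(k − j)⁻³ + Õ(1/(j(k − j)²))` and similarly
> `ψ_T(k) = ψ_T(j) + Õ(|k − j|/T)`, and the claim follows by direct computation using the fact that
> `k ↦ 1/(k − j)` is odd around `j`.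

(`X ≲ Y`, `X = Õ(Y)`: `X ≪ Y log^{O(1)} T`, §1.2; `ψ_T(j) = (1 + |j|/(T log T))^{−100}`, (66).)

## What this file proves (all RH-FREE, `t`-free; 0 definitions, 0 named facts)

* `RodgersTao2020.tsum_truncWeight_div_cube_classicalLocationZ_le` — the reduced display in
  bold above, explicit: `∃ C ≥ 0, ∀ T ≥ 3, ∀ j ∈ ℤ*`, the family
  `k ↦ ψ_T(k)/(ξ_k − ξ_j)³` on `ℤ* ∖ {j}` (extended by `0` to `ℤ`) is summable and
  `|Σ'_k ψ_T(k)/(ξ_k − ξ_j)³| ≤ C log³ T · (1/|j| + 1/T)`. The summand is written over `ℤ` with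
  the indicator `if k = 0 ∨ k = j then 0 else …` so that PART II can reach it from the
  `zstarOffDiag`-indexed series of `truncEnergy` by Fubini.
* `RodgersTaoTruncEnergy.abs_truncWeight_sub_le` / `…_of_near` — the weight `ψ_T` is Lipschitz
  at scale `T log T` with its decay built in: `|ψ_T(k) − ψ_T(j)| ≤ 100|k − j|/(T log T + min(|j|,|k|))`,
  hence `≤ 200|k − j|/(2T log T + |j|)` on the near range («`ψ_T(k) = ψ_T(j) + Õ(|k − j|/T)`»).
* `RodgersTaoTruncEnergy.hasSum_inv_cube_sub` / `…_zstar` — «`k ↦ 1/(k − j)` is odd around `j`»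
  made exact: `Σ_{k ∈ ℤ ∖ {j}} (j − k)⁻³ = 0`, `Σ_{k ∈ ℤ* ∖ {j}} (j − k)⁻³ = −1/j³`.
* `RodgersTaoTruncEnergy.sum_abs_weightedError_le`, `sum_abs_oscillation_le`,
  `far_comparison`, `final_bookkeeping` — the three pieces of the inner sum (comparison error,
  oscillation of `ψ_T`, lattice term) as uniform bounds on finite partial sums, and the final
  arithmetic.

## Proof route and divergences from print

The proof is the printed one. Writing `(ξ_k − ξ_j)⁻³ = −[(ℓ_j/4π)³(j − k)⁻³ + e_j(k)]`,
`ℓ_j := log(ξ_{|j|}/4π)`, with the two comparisons of the Lemma 16 file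
(`RodgersTaoRenormEnergy.lattice_comparison_fine`: `|e_j(k)| ≤ K₄ℓ_j²/(|j|(j − k)²)` on the near
range `|k − j| < |j|/2`, from the corrected (45); `lattice_comparison_crude` + (44) on the far
range, here in the form `far_comparison`: `|e_j(k)| ≤ D/(j − k)²` after
`(log(2 + 5B) + log|j − k|)³ ≤ (log(2 + 5B) + 3)³|j − k|`), and `ψ_T(k) = ψ_T(j) + (ψ_T(k) − ψ_T(j))`:
`Σ_k ψ_T(k)/(ξ_k − ξ_j)³ = −Σ_k ψ_T(k)e_j(k) − (ℓ_j/4π)³[ψ_T(j)Σ_{k ∈ ℤ*∖{j}}(j − k)⁻³ + Σ_k (ψ_T(k) − ψ_T(j))(j − k)⁻³]`,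
with `Σ_{k ∈ ℤ*∖{j}}(j − k)⁻³ = −1/j³` (oddness, exact), `|Σ ψ e| ≤ 4K₄ℓ_j²/|j| + 8D/|j|` and
`|Σ(ψ_T(k) − ψ_T(j))(j − k)⁻³| ≤ 800/(2T log T + |j|) + 16/j²`. Bookkeeping choices:
1. **Explicit `≲`.** The printed `log^{O(1)} T` becomes `log³ T` with threshold `T ≥ 3`; the
   powers `ℓ_j^p ≤ (log B + log|j|)^p` (`|ξ_j| ≤ B|j|`, (43)) are absorbed by
   `(A + log x)^p ≤ (A + 2p)^p log^p T (1 + x/T)` (`x ≥ 1`, `T ≥ 3`; split at `x = T²`, using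
   `log x ≤ x^ε/ε`), which is where the two terms `1/|j|` and `1/T` of the printed bound arise.
2. The far range is summed with the crude bound `|ψ_T| ≤ 1` (the decay of `ψ_T` is not needed
   there), the near-range oscillation with the built-in decay of the Lipschitz bound
   (`1/(T log T + |j|/2)`), which is what makes the estimate uniform in `j ∈ ℤ*` as printed.
3. Summability over `ℤ` is obtained from uniform bounds on finite partial sums of absolute
   values (`summable_of_sum_le`), piece by piece.

## References

* [RodgersTaoFMP2020] B. Rodgers, T. Tao, *The de Bruijn–Newman constant is non-negative*, Forum
  Math. Pi 8 (2020), e6, doi:10.1017/fmp.2020.6 (= arXiv:1801.05914v5): §7 (66)–(67) p. 42,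
  Lemma 18 and its proof pp. 42–43 (= arXiv v4 Lemma 7.3, TeX l. 1059–1083); Lemma 16 p. 41;
  §3 Lemma 8 (43)–(45) p. 21; §1.2 p. 7 (`ℤ*`, `≲`, `Õ`).
-/

noncomputable section

open Real Finset

namespace Literature.NumberTheory.LFunctions

namespace RodgersTaoTruncEnergy

/-! ## Elementary sums over `ℕ` (module-private plumbing) -/

/-- `Σ_{m=1}^{N} 1/m² ≤ 2`. [folklore] -/
private theorem sum_Icc_inv_sq_le_two (N : ℕ) : ∑ m ∈ Icc 1 N, 1 / (m : ℝ) ^ 2 ≤ 2 := by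
  have h := sum_Ioo_inv_sq_le (α := ℝ) 0 (N + 1)
  have hI : Icc 1 N = Ioo 0 (N + 1) := by
    ext m
    simp only [mem_Icc, mem_Ioo]
    omega
  rw [hI]
  norm_num at h
  simpa [one_div] using h

/-- Tail of `Σ 1/m²`: for `M ≥ 1`, `Σ_{m=M}^{N} 1/m² ≤ 2/M`. [folklore] -/
private theorem sum_Icc_inv_sq_le {M : ℕ} (hM : 1 ≤ M) (N : ℕ) :
    ∑ m ∈ Icc M N, 1 / (m : ℝ) ^ 2 ≤ 2 / (M : ℝ) := by
  have h := sum_Ioo_inv_sq_le (α := ℝ) (M - 1) (N + 1)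
  have hI : Icc M N = Ioo (M - 1) (N + 1) := by
    ext m
    simp only [mem_Icc, mem_Ioo]
    omega
  have hcast : ((M - 1 : ℕ) : ℝ) + 1 = M := by
    rw [Nat.cast_sub hM]
    push_cast
    ring
  rw [hcast] at h
  rw [hI]
  simpa [one_div] using h

/-- Tail of `Σ 1/m³`: for `M ≥ 1`, `Σ_{m=M}^{N} 1/m³ ≤ 2/M²`. [folklore] -/
private theorem sum_Icc_inv_cube_le {M : ℕ} (hM : 1 ≤ M) (N : ℕ) :
    ∑ m ∈ Icc M N, 1 / (m : ℝ) ^ 3 ≤ 2 / (M : ℝ) ^ 2 := by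
  have hM0 : (0 : ℝ) < M := by exact_mod_cast hM
  calc ∑ m ∈ Icc M N, 1 / (m : ℝ) ^ 3
      ≤ ∑ m ∈ Icc M N, (1 / (M : ℝ)) * (1 / (m : ℝ) ^ 2) := by
        refine sum_le_sum fun m hm ↦ ?_
        have hm : (M : ℝ) ≤ m := by exact_mod_cast (mem_Icc.1 hm).1
        have hm0 : (0 : ℝ) < m := hM0.trans_le hm
        rw [div_mul_div_comm, one_mul, div_le_div_iff₀ (by positivity) (by positivity)]
        nlinarith [mul_nonneg (sub_nonneg.2 hm) (sq_nonneg (m : ℝ))]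
    _ = (1 / (M : ℝ)) * ∑ m ∈ Icc M N, 1 / (m : ℝ) ^ 2 := by rw [mul_sum]
    _ ≤ (1 / (M : ℝ)) * (2 / (M : ℝ)) := by
        gcongr
        exact sum_Icc_inv_sq_le hM N
    _ = 2 / (M : ℝ) ^ 2 := by ring

/-- Covering a finite set of integers at distance `∈ [M, N]` from `k` by the two rays `k ± m`:
for `g ≥ 0`, `Σ_{j ∈ S} g(j) ≤ Σ_{m=M}^{N} (g(k + m) + g(k − m))`. [folklore] -/
private theorem sum_le_sum_Icc_shift (S : Finset ℤ) (k : ℤ) {M N : ℕ} (g : ℤ → ℝ)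
    (hg : ∀ j, 0 ≤ g j) (hS : ∀ j ∈ S, (M : ℤ) ≤ |j - k| ∧ |j - k| ≤ N) :
    ∑ j ∈ S, g j ≤ ∑ m ∈ Icc M N, (g (k + m) + g (k - m)) := by
  classical
  rw [sum_add_distrib, ← sum_filter_add_sum_filter_not S (fun j ↦ k ≤ j) g]
  refine add_le_add ?_ ?_
  · have hsub : S.filter (fun j ↦ k ≤ j) ⊆ (Icc M N).image (fun m : ℕ ↦ k + m) := by
      intro j hj
      rw [mem_filter] at hj
      obtain ⟨hjS, hkj⟩ := hj
      obtain ⟨h1, h2⟩ := hS j hjS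
      rw [abs_of_nonneg (sub_nonneg.2 hkj)] at h1 h2
      refine mem_image.2 ⟨(j - k).toNat, ?_, ?_⟩
      · rw [mem_Icc]; constructor <;> omega
      · omega
    calc ∑ j ∈ S.filter (fun j ↦ k ≤ j), g j
        ≤ ∑ j ∈ (Icc M N).image (fun m : ℕ ↦ k + m), g j :=
          sum_le_sum_of_subset_of_nonneg hsub fun j _ _ ↦ hg j
      _ = ∑ m ∈ Icc M N, g (k + m) := by
          rw [sum_image]
          intro x _ y _ h
          simpa using h
  · have hsub : S.filter (fun j ↦ ¬ k ≤ j) ⊆ (Icc M N).image (fun m : ℕ ↦ k - m) := by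
      intro j hj
      rw [mem_filter] at hj
      obtain ⟨hjS, hkj⟩ := hj
      obtain ⟨h1, h2⟩ := hS j hjS
      rw [abs_of_neg (by omega)] at h1 h2
      refine mem_image.2 ⟨(k - j).toNat, ?_, ?_⟩
      · rw [mem_Icc]; constructor <;> omega
      · omega
    calc ∑ j ∈ S.filter (fun j ↦ ¬ k ≤ j), g j
        ≤ ∑ j ∈ (Icc M N).image (fun m : ℕ ↦ k - m), g j :=
          sum_le_sum_of_subset_of_nonneg hsub fun j _ _ ↦ hg j
      _ = ∑ m ∈ Icc M N, g (k - m) := by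
          rw [sum_image]
          intro x _ y _ h
          simpa using h

/-- The largest distance from `j` occurring in a finite set, as a natural number. [folklore] -/
private theorem exists_abs_sub_le (S : Finset ℤ) (j : ℤ) :
    ∃ N : ℕ, ∀ k ∈ S, |k - j| ≤ N := by
  refine ⟨S.sup (fun k ↦ (k - j).natAbs), fun k hk ↦ ?_⟩
  have h := Finset.le_sup (f := fun k ↦ (k - j).natAbs) hk
  have h' : ((k - j).natAbs : ℤ) ≤ ((S.sup fun k ↦ (k - j).natAbs : ℕ) : ℤ) := by exact_mod_cast h
  rwa [Int.natCast_natAbs] at h'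

/-! ## Growth absorption: `(A + log x)^p ≪_p (log T)^p (1 + x/T)` -/

/-- `log x ≤ 3 x^{1/3}` and hence `(A + log x)³ ≤ (A + 3)³ x` for `x ≥ 1`, `A ≥ 0`. [folklore] -/
private theorem add_log_pow_three_le {A x : ℝ} (hA : 0 ≤ A) (hx : 1 ≤ x) :
    (A + Real.log x) ^ 3 ≤ (A + 3) ^ 3 * x := by
  have hx0 : 0 ≤ x := by linarith
  have h1 : Real.log x ≤ x ^ (1 / 3 : ℝ) / (1 / 3) := Real.log_le_rpow_div hx0 (by norm_num)
  have h2 : (1 : ℝ) ≤ x ^ (1 / 3 : ℝ) := Real.one_le_rpow hx (by norm_num)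
  have h3 : A + Real.log x ≤ (A + 3) * x ^ (1 / 3 : ℝ) := by nlinarith
  have h4 : 0 ≤ A + Real.log x := by
    have := Real.log_nonneg hx
    linarith
  have h5 : (x ^ (1 / 3 : ℝ)) ^ 3 = x := by
    rw [← Real.rpow_mul_natCast hx0]
    norm_num
  calc (A + Real.log x) ^ 3 ≤ ((A + 3) * x ^ (1 / 3 : ℝ)) ^ 3 := pow_le_pow_left₀ h4 h3 3
    _ = (A + 3) ^ 3 * x := by rw [mul_pow, h5]

/-- Absorption of powers of logarithms: for `T ≥ 3`, `x ≥ 1`, `A ≥ 0`, `p ≥ 1`: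
`(A + log x)^p ≤ (A + 2p)^p (log T)^p (1 + x/T)` (split at `x = T²`: below, `log x ≤ 2 log T`;
above, `log x ≤ 2p·x^{1/(2p)}` and `x^{1/2} ≤ x/T`). [folklore] -/
private theorem add_log_pow_le {A : ℝ} (hA : 0 ≤ A) {p : ℕ} (hp : 1 ≤ p) {T x : ℝ} (hT : 3 ≤ T)
    (hx : 1 ≤ x) :
    (A + Real.log x) ^ p ≤ (A + 2 * p) ^ p * Real.log T ^ p * (1 + x / T) := by
  have hT0 : 0 < T := by linarith
  have hx0 : 0 < x := by linarith
  have hp0 : (0 : ℝ) < p := by exact_mod_cast hp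
  have hlogT : 1 ≤ Real.log T := by
    rw [← Real.log_exp 1]
    refine Real.log_le_log (Real.exp_pos 1) ?_
    have := Real.exp_one_lt_d9
    linarith
  have hlogx : 0 ≤ Real.log x := Real.log_nonneg hx
  have hAx : 0 ≤ A + Real.log x := by linarith
  have hxT : 0 ≤ x / T := by positivity
  rcases le_or_gt x (T ^ 2) with hle | hgt
  · -- `log x ≤ 2 log T`
    have h1 : Real.log x ≤ 2 * Real.log T := by
      rw [← Real.log_rpow hT0, Real.rpow_two]
      exact Real.log_le_log hx0 hle
    have h2 : A + Real.log x ≤ (A + 2 * p) * Real.log T := by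
      have e1 : A * 1 ≤ A * Real.log T := mul_le_mul_of_nonneg_left hlogT hA
      have e2 : 1 * Real.log T ≤ (p : ℝ) * Real.log T :=
        mul_le_mul_of_nonneg_right (by exact_mod_cast hp) (by linarith)
      have e3 : (A + 2 * p) * Real.log T = A * Real.log T + 2 * ((p : ℝ) * Real.log T) := by ring
      linarith
    calc (A + Real.log x) ^ p ≤ ((A + 2 * p) * Real.log T) ^ p := pow_le_pow_left₀ hAx h2 p
      _ = (A + 2 * p) ^ p * Real.log T ^ p * 1 := by rw [mul_pow, mul_one]
      _ ≤ (A + 2 * p) ^ p * Real.log T ^ p * (1 + x / T) := by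
          gcongr
          linarith
  · -- `log x ≤ 2p x^{1/(2p)}`, `x^{1/2} ≤ x/T`
    set ε : ℝ := 1 / (2 * p) with hε
    have hε0 : 0 < ε := by positivity
    have h1 : Real.log x ≤ x ^ ε / ε := Real.log_le_rpow_div hx0.le hε0
    have h1' : Real.log x ≤ 2 * p * x ^ ε := by
      rw [hε] at h1 ⊢
      rw [div_div_eq_mul_div, div_one] at h1  -- x^ε / (1/(2p)) = x^ε * 2p
      linarith [h1]
    have h2 : (1 : ℝ) ≤ x ^ ε := Real.one_le_rpow hx hε0.le
    have h3 : A + Real.log x ≤ (A + 2 * p) * x ^ ε := by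
      have e1 : A * 1 ≤ A * x ^ ε := mul_le_mul_of_nonneg_left h2 hA
      have e3 : (A + 2 * p) * x ^ ε = A * x ^ ε + 2 * p * x ^ ε := by ring
      linarith
    have h4 : (x ^ ε) ^ p = x ^ (1 / 2 : ℝ) := by
      rw [← Real.rpow_mul_natCast hx0.le, hε]
      congr 1
      field_simp
    have h5 : x ^ (1 / 2 : ℝ) ≤ x / T := by
      -- `T ≤ x^{1/2}` since `T² < x`
      have hT2 : T ≤ x ^ (1 / 2 : ℝ) := by
        have : (T ^ 2) ^ (1 / 2 : ℝ) ≤ x ^ (1 / 2 : ℝ) :=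
          Real.rpow_le_rpow (by positivity) hgt.le (by norm_num)
        rwa [← Real.rpow_natCast, ← Real.rpow_mul hT0.le, show ((2 : ℕ) : ℝ) * (1 / 2) = 1 by
          norm_num, Real.rpow_one] at this
      have hsq : x ^ (1 / 2 : ℝ) * x ^ (1 / 2 : ℝ) = x := by
        rw [← Real.rpow_add hx0]
        norm_num
      rw [le_div_iff₀ hT0]
      calc x ^ (1 / 2 : ℝ) * T ≤ x ^ (1 / 2 : ℝ) * x ^ (1 / 2 : ℝ) := by
            gcongr
        _ = x := hsq
    calc (A + Real.log x) ^ p ≤ ((A + 2 * p) * x ^ ε) ^ p := pow_le_pow_left₀ hAx h3 p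
      _ = (A + 2 * p) ^ p * x ^ (1 / 2 : ℝ) := by rw [mul_pow, h4]
      _ ≤ (A + 2 * p) ^ p * (x / T) := by gcongr
      _ ≤ (A + 2 * p) ^ p * Real.log T ^ p * (1 + x / T) := by
          have hlp : 1 ≤ Real.log T ^ p := one_le_pow₀ hlogT
          have hAp : 0 ≤ (A + 2 * p) ^ p := by positivity
          nlinarith [mul_nonneg hAp hxT, mul_nonneg hAp (mul_nonneg (sub_nonneg.2 hlp) hxT)]

/-! ## The weight `ψ_T` (66): a Lipschitz bound -/

/-- For `0 ≤ a ≤ b`, `N > 0`, `n ≥ 1`: `0 ≤ (1 + a/N)^{−n} − (1 + b/N)^{−n} ≤ n (b − a)/(N + a)`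
(from `vⁿ − uⁿ = (v − u)Σ vⁱ u^{n−1−i} ≤ n (v − u) v^{n−1}`). [folklore] -/
private theorem inv_pow_sub_inv_pow_le {n : ℕ} (hn : 1 ≤ n) {a b N : ℝ} (hN : 0 < N) (ha : 0 ≤ a)
    (hab : a ≤ b) :
    0 ≤ ((1 + a / N) ^ n)⁻¹ - ((1 + b / N) ^ n)⁻¹ ∧
      ((1 + a / N) ^ n)⁻¹ - ((1 + b / N) ^ n)⁻¹ ≤ n * (b - a) / (N + a) := by
  set u : ℝ := 1 + a / N with hu_def
  set v : ℝ := 1 + b / N with hv_def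
  have haN : 0 ≤ a / N := by positivity
  have hu1 : 1 ≤ u := by
    rw [hu_def]
    linarith
  have hu0 : 0 < u := by linarith
  have huv : u ≤ v := by
    rw [hu_def, hv_def]
    gcongr
  have hv1 : 1 ≤ v := hu1.trans huv
  have hv0 : 0 < v := by linarith
  constructor
  · exact sub_nonneg.2 (inv_anti₀ (pow_pos hu0 n) (pow_le_pow_left₀ hu0.le huv n))
  · have hgeom : (∑ i ∈ range n, v ^ i * u ^ (n - 1 - i)) * (v - u) = v ^ n - u ^ n :=
      geom_sum₂_mul v u n
    have hsum : ∑ i ∈ range n, v ^ i * u ^ (n - 1 - i) ≤ n * v ^ (n - 1) := by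
      calc ∑ i ∈ range n, v ^ i * u ^ (n - 1 - i) ≤ ∑ i ∈ range n, v ^ (n - 1) := by
            refine sum_le_sum fun i hi ↦ ?_
            have hi' : i < n := mem_range.1 hi
            calc v ^ i * u ^ (n - 1 - i) ≤ v ^ i * v ^ (n - 1 - i) := by
                  gcongr
              _ = v ^ (n - 1) := by
                  rw [← pow_add]
                  congr 1
                  omega
        _ = n * v ^ (n - 1) := by simp
    have hdiff : v ^ n - u ^ n ≤ n * v ^ (n - 1) * (v - u) := by
      rw [← hgeom]
      exact mul_le_mul_of_nonneg_right hsum (sub_nonneg.2 huv)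
    have hun : 0 < u ^ n := pow_pos hu0 n
    have hvn : 0 < v ^ n := pow_pos hv0 n
    have key : (u ^ n)⁻¹ - (v ^ n)⁻¹ = (v ^ n - u ^ n) / (u ^ n * v ^ n) := by
      field_simp
    rw [key]
    have hvsplit : v ^ n = v ^ (n - 1) * v := by
      rw [← pow_succ, Nat.sub_add_cancel hn]
    have hupow : u ≤ u ^ n := le_self_pow₀ hu1 (by omega)
    have hn0 : (0 : ℝ) ≤ n := Nat.cast_nonneg n
    calc (v ^ n - u ^ n) / (u ^ n * v ^ n)
        ≤ n * v ^ (n - 1) * (v - u) / (u ^ n * v ^ n) :=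
          div_le_div_of_nonneg_right hdiff (by positivity)
      _ = n * (v - u) / (u ^ n * v) := by
          rw [hvsplit]
          have hvn1 : 0 < v ^ (n - 1) := pow_pos hv0 (n - 1)
          field_simp
      _ ≤ n * (v - u) / (u * 1) := by
          apply div_le_div_of_nonneg_left (mul_nonneg hn0 (sub_nonneg.2 huv)) (by positivity)
          exact mul_le_mul hupow hv1 zero_le_one hun.le
      _ = n * (b - a) / (N + a) := by
          rw [hu_def, hv_def, mul_one]
          field_simp
          ring

/-- RH-FREE. The weight `ψ_T` of (66) is Lipschitz at scale `T log T`, with the decay built in: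
`|ψ_T(k) − ψ_T(j)| ≤ 100 |k − j|/(T log T + min(|j|, |k|))` for all `j, k ∈ ℤ` (`T log T > 0`)
— the printed «`ψ_T(k) = ψ_T(j) + Õ(|k − j|/T)`» (FMP p. 43, proof of Lemma 18) made explicit.
[cite: RodgersTaoFMP2020, §7 p. 42 (66) and p. 43 (proof of Lemma 18)] -/
theorem abs_truncWeight_sub_le {T : ℝ} (hT : 0 < T * Real.log T) (j k : ℤ) :
    |truncWeight T k - truncWeight T j| ≤
      100 * |(k : ℝ) - j| / (T * Real.log T + min |(j : ℝ)| |(k : ℝ)|) := by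
  set N : ℝ := T * Real.log T with hN_def
  have htri : |(|(k : ℝ)| - |(j : ℝ)|)| ≤ |(k : ℝ) - j| := abs_abs_sub_abs_le_abs_sub _ _
  rw [truncWeight_eq, truncWeight_eq]
  rcases le_total |(j : ℝ)| |(k : ℝ)| with hjk | hkj
  · -- `a = |j| ≤ b = |k|`
    obtain ⟨h0, h1⟩ := inv_pow_sub_inv_pow_le (n := 100) (by norm_num) hT (abs_nonneg (j : ℝ)) hjk
    simp only [Nat.cast_ofNat] at h1
    rw [min_eq_left hjk, abs_sub_comm, abs_of_nonneg h0]
    refine h1.trans ?_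
    have hden : 0 < T * Real.log T + |(j : ℝ)| := by positivity
    rw [div_le_div_iff_of_pos_right hden]
    have : |(k : ℝ)| - |(j : ℝ)| ≤ |(k : ℝ) - j| := by
      have := le_abs_self (|(k : ℝ)| - |(j : ℝ)|)
      linarith
    linarith
  · obtain ⟨h0, h1⟩ := inv_pow_sub_inv_pow_le (n := 100) (by norm_num) hT (abs_nonneg (k : ℝ)) hkj
    simp only [Nat.cast_ofNat] at h1
    rw [min_eq_right hkj, abs_of_nonneg h0]
    refine h1.trans ?_
    have hden : 0 < T * Real.log T + |(k : ℝ)| := by positivity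
    rw [div_le_div_iff_of_pos_right hden]
    have : |(j : ℝ)| - |(k : ℝ)| ≤ |(k : ℝ) - j| := by
      have := neg_le_abs (|(k : ℝ)| - |(j : ℝ)|)
      linarith
    linarith

/-- RH-FREE. On the near range `|k − j| < |j|/2` (so `min(|j|,|k|) ≥ |j|/2`):
`|ψ_T(k) − ψ_T(j)| ≤ 200 |k − j|/(2 T log T + |j|)`.
[cite: RodgersTaoFMP2020, §7 p. 43 (proof of Lemma 18: «ψ_T(k) = ψ_T(j) + Õ(|k − j|/T)»)] -/
theorem abs_truncWeight_sub_le_of_near {T : ℝ} (hT : 0 < T * Real.log T) {j k : ℤ}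
    (hnear : 2 * |j - k| < |j|) :
    |truncWeight T k - truncWeight T j| ≤
      200 * |(k : ℝ) - j| / (2 * (T * Real.log T) + |(j : ℝ)|) := by
  have h := abs_truncWeight_sub_le hT j k
  have h1 : (j : ℤ) - k ≤ |j - k| := le_abs_self _
  have h2 : -(j - k) ≤ |j - k| := neg_le_abs _
  have h3 : j ≤ |j| := le_abs_self _
  have h4 : -j ≤ |j| := neg_le_abs _
  have hmin : |(j : ℝ)| ≤ 2 * min |(j : ℝ)| |(k : ℝ)| := by
    have hk2 : |j| ≤ 2 * |k| := by
      have h5 : |j| - |k| ≤ |j - k| := abs_sub_abs_le_abs_sub j k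
      omega
    have hk2R : |(j : ℝ)| ≤ 2 * |(k : ℝ)| := by
      rw [← Int.cast_abs, ← Int.cast_abs]; exact_mod_cast hk2
    rcases le_total |(j : ℝ)| |(k : ℝ)| with hle | hle
    · rw [min_eq_left hle]; linarith [abs_nonneg (j : ℝ)]
    · rw [min_eq_right hle]; exact hk2R
  refine h.trans ?_
  have hd1 : 0 < T * Real.log T + min |(j : ℝ)| |(k : ℝ)| := by positivity
  have hd2 : 0 < 2 * (T * Real.log T) + |(j : ℝ)| := by positivity
  rw [div_le_div_iff₀ hd1 hd2]
  nlinarith [abs_nonneg ((k : ℝ) - j), hT]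


/-! ## The three pieces of the weighted inner sum: error, oscillation, lattice -/

/-- ERROR PIECE (finite sums): with the lattice comparisons of the proof of Lemma 16 (near range:
`K₄ ℓ_j²/(|j|(j − k)²)`; far range: `D/(j − k)²`) and `0 ≤ ψ_T ≤ 1`,
`Σ_{k ∈ S} |ψ_T(k)((ξ_j − ξ_k)⁻³ − (ℓ_j/4π)³(j − k)⁻³)| ≤ 4K₄ℓ_j²/|j| + 8D/|j|` for every finite `S`.
[cite: RodgersTaoFMP2020, §7 proof of Lemma 18, p. 43 («As in the proof of Lemma 16 … the contribution of those k with |k − j| ≥ j/2 is acceptable … for the remaining range we again use (45)»)] -/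
theorem sum_abs_weightedError_le {ψ : ℤ → ℝ} (hψ0 : ∀ k, 0 ≤ ψ k) (hψ1 : ∀ k, ψ k ≤ 1)
    {j : ℤ} (hj : j ≠ 0) {ℓ K₄ D : ℝ} (hK₄ : 0 ≤ K₄) (hD : 0 ≤ D) {e : ℤ → ℝ}
    (hfine : ∀ k : ℤ, k ≠ 0 → k ≠ j → 2 * |j - k| < |j| →
      |e k| ≤ K₄ * (ℓ ^ 2 / (|(j : ℝ)| * ((j : ℝ) - k) ^ 2)))
    (hfar : ∀ k : ℤ, k ≠ 0 → k ≠ j → ¬ 2 * |j - k| < |j| → |e k| ≤ D / ((j : ℝ) - k) ^ 2)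
    (S : Finset ℤ) :
    ∑ k ∈ S, |(if k = 0 ∨ k = j then (0 : ℝ) else ψ k * e k)| ≤
      4 * K₄ * ℓ ^ 2 / |(j : ℝ)| + 8 * D / |(j : ℝ)| := by
  classical
  have hjR : (0 : ℝ) < |(j : ℝ)| := abs_pos.2 (by exact_mod_cast hj)
  obtain ⟨N, hN⟩ := exists_abs_sub_le S j
  -- drop the vanishing terms
  set S₀ := S.filter (fun k ↦ k ≠ 0 ∧ k ≠ j) with hS₀
  have hdrop : ∑ k ∈ S, |(if k = 0 ∨ k = j then (0 : ℝ) else ψ k * e k)| =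
      ∑ k ∈ S₀, ψ k * |e k| := by
    rw [hS₀, sum_filter]
    refine sum_congr rfl fun k _ ↦ ?_
    by_cases h : k = 0 ∨ k = j
    · rw [if_pos h, if_neg (by tauto), abs_zero]
    · rw [if_neg h, if_pos (by tauto), abs_mul, abs_of_nonneg (hψ0 k)]
  rw [hdrop]
  have hmem : ∀ k ∈ S₀, k ≠ 0 ∧ k ≠ j ∧ k ∈ S := fun k hk ↦ by
    rw [hS₀, mem_filter] at hk
    exact ⟨hk.2.1, hk.2.2, hk.1⟩
  rw [← sum_filter_add_sum_filter_not S₀ (fun k ↦ 2 * |j - k| < |j|)]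
  refine add_le_add ?_ ?_
  · -- near range
    set g : ℤ → ℝ := fun k ↦ K₄ * (ℓ ^ 2 / (|(j : ℝ)| * ((j : ℝ) - k) ^ 2)) with hg
    have hg0 : ∀ k, 0 ≤ g k := fun k ↦ by positivity
    calc ∑ k ∈ S₀.filter (fun k ↦ 2 * |j - k| < |j|), ψ k * |e k|
        ≤ ∑ k ∈ S₀.filter (fun k ↦ 2 * |j - k| < |j|), g k := by
          refine sum_le_sum fun k hk ↦ ?_
          rw [mem_filter] at hk
          obtain ⟨hk0, hkj, -⟩ := hmem k hk.1
          calc ψ k * |e k| ≤ 1 * |e k| :=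
                mul_le_mul_of_nonneg_right (hψ1 k) (abs_nonneg _)
            _ ≤ g k := by rw [one_mul]; exact hfine k hk0 hkj hk.2
      _ ≤ ∑ m ∈ Icc 1 N, (g (j + m) + g (j - m)) := by
          refine sum_le_sum_Icc_shift _ j g hg0 fun k hk ↦ ?_
          obtain ⟨-, hkj, hkS⟩ := hmem k (mem_filter.1 hk).1
          exact ⟨by exact_mod_cast Int.one_le_abs (sub_ne_zero.2 hkj), by exact_mod_cast hN k hkS⟩
      _ = ∑ m ∈ Icc 1 N, (2 * (K₄ * ℓ ^ 2 / |(j : ℝ)|)) * (1 / (m : ℝ) ^ 2) := by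
          refine sum_congr rfl fun m hm ↦ ?_
          have e1 : ((j : ℝ) - ((j + (m : ℤ) : ℤ) : ℝ)) ^ 2 = (m : ℝ) ^ 2 := by
            push_cast
            ring
          have e2 : ((j : ℝ) - ((j - (m : ℤ) : ℤ) : ℝ)) ^ 2 = (m : ℝ) ^ 2 := by
            push_cast
            ring
          simp only [hg]
          rw [e1, e2]
          ring
      _ = (2 * (K₄ * ℓ ^ 2 / |(j : ℝ)|)) * ∑ m ∈ Icc 1 N, 1 / (m : ℝ) ^ 2 := by rw [mul_sum]
      _ ≤ (2 * (K₄ * ℓ ^ 2 / |(j : ℝ)|)) * 2 := by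
          gcongr
          exact sum_Icc_inv_sq_le_two N
      _ = 4 * K₄ * ℓ ^ 2 / |(j : ℝ)| := by ring
  · -- far range
    set g : ℤ → ℝ := fun k ↦ D / ((j : ℝ) - k) ^ 2 with hg
    have hg0 : ∀ k, 0 ≤ g k := fun k ↦ by positivity
    set M : ℕ := (j.natAbs + 1) / 2 with hM_def
    have hM1 : 1 ≤ M := by
      have : 1 ≤ j.natAbs := Int.natAbs_pos.2 hj
      omega
    have hM2 : j.natAbs ≤ 2 * M := by omega
    have hMR : |(j : ℝ)| ≤ 2 * (M : ℝ) := by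
      have e : ((j.natAbs : ℕ) : ℝ) = |(j : ℝ)| := by rw [Nat.cast_natAbs, Int.cast_abs]
      rw [← e]
      exact_mod_cast hM2
    have hMR0 : (0 : ℝ) < M := by exact_mod_cast hM1
    have hjabs : ((j.natAbs : ℕ) : ℤ) = |j| := Int.natCast_natAbs j
    calc ∑ k ∈ S₀.filter (fun k ↦ ¬ 2 * |j - k| < |j|), ψ k * |e k|
        ≤ ∑ k ∈ S₀.filter (fun k ↦ ¬ 2 * |j - k| < |j|), g k := by
          refine sum_le_sum fun k hk ↦ ?_
          rw [mem_filter] at hk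
          obtain ⟨hk0, hkj, -⟩ := hmem k hk.1
          calc ψ k * |e k| ≤ 1 * |e k| :=
                mul_le_mul_of_nonneg_right (hψ1 k) (abs_nonneg _)
            _ ≤ g k := by rw [one_mul]; exact hfar k hk0 hkj hk.2
      _ ≤ ∑ m ∈ Icc M N, (g (j + m) + g (j - m)) := by
          refine sum_le_sum_Icc_shift _ j g hg0 fun k hk ↦ ?_
          obtain ⟨hkS₀, hfark⟩ := mem_filter.1 hk
          obtain ⟨-, hkj, hkS⟩ := hmem k hkS₀
          rw [not_lt] at hfark
          have h1 : j - k ≤ |j - k| := le_abs_self _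
          have h2 : -(j - k) ≤ |j - k| := neg_le_abs _
          have h3 : j ≤ |j| := le_abs_self _
          have h4 : -j ≤ |j| := neg_le_abs _
          rw [abs_sub_comm] at hfark
          refine ⟨?_, by exact_mod_cast hN k hkS⟩
          push_cast [hM_def]
          omega
      _ = ∑ m ∈ Icc M N, (2 * D) * (1 / (m : ℝ) ^ 2) := by
          refine sum_congr rfl fun m hm ↦ ?_
          have e1 : ((j : ℝ) - ((j + (m : ℤ) : ℤ) : ℝ)) ^ 2 = (m : ℝ) ^ 2 := by
            push_cast
            ring
          have e2 : ((j : ℝ) - ((j - (m : ℤ) : ℤ) : ℝ)) ^ 2 = (m : ℝ) ^ 2 := by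
            push_cast
            ring
          simp only [hg]
          rw [e1, e2]
          ring
      _ = (2 * D) * ∑ m ∈ Icc M N, 1 / (m : ℝ) ^ 2 := by rw [mul_sum]
      _ ≤ (2 * D) * (2 / (M : ℝ)) := by
          gcongr
          exact sum_Icc_inv_sq_le hM1 N
      _ ≤ (2 * D) * (4 / |(j : ℝ)|) := by
          gcongr 2 * D * ?_
          rw [div_le_div_iff₀ hMR0 hjR]
          nlinarith
      _ = 8 * D / |(j : ℝ)| := by ring

/-- OSCILLATION PIECE (finite sums): with `|ψ_T(k) − ψ_T(j)| ≤ D_j |k − j|` on the near range and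
`|ψ_T(k) − ψ_T(j)| ≤ 1` everywhere, `Σ_{k ∈ S} |(ψ_T(k) − ψ_T(j))/(j − k)³| ≤ 4D_j + 16/j²`.
[cite: RodgersTaoFMP2020, §7 proof of Lemma 18, p. 43 («ψ_T(k) = ψ_T(j) + Õ(|k − j|/T)»)] -/
theorem sum_abs_oscillation_le {ψ : ℤ → ℝ} (hψ0 : ∀ k, 0 ≤ ψ k) (hψ1 : ∀ k, ψ k ≤ 1)
    {j : ℤ} (hj : j ≠ 0) {Dj : ℝ} (hDj : 0 ≤ Dj)
    (hLip : ∀ k : ℤ, k ≠ 0 → k ≠ j → 2 * |j - k| < |j| → |ψ k - ψ j| ≤ Dj * |(k : ℝ) - j|)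
    (S : Finset ℤ) :
    ∑ k ∈ S, |(if k = 0 ∨ k = j then (0 : ℝ) else (ψ k - ψ j) / ((j : ℝ) - k) ^ 3)| ≤
      4 * Dj + 16 / (j : ℝ) ^ 2 := by
  classical
  have hjR : (0 : ℝ) < |(j : ℝ)| := abs_pos.2 (by exact_mod_cast hj)
  obtain ⟨N, hN⟩ := exists_abs_sub_le S j
  have hψd : ∀ k, |ψ k - ψ j| ≤ 1 := fun k ↦ by
    rw [abs_le]
    constructor <;> linarith [hψ0 k, hψ1 k, hψ0 j, hψ1 j]
  set S₀ := S.filter (fun k ↦ k ≠ 0 ∧ k ≠ j) with hS₀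
  have hdrop : ∑ k ∈ S, |(if k = 0 ∨ k = j then (0 : ℝ) else (ψ k - ψ j) / ((j : ℝ) - k) ^ 3)| =
      ∑ k ∈ S₀, |ψ k - ψ j| / |(j : ℝ) - k| ^ 3 := by
    rw [hS₀, sum_filter]
    refine sum_congr rfl fun k _ ↦ ?_
    by_cases h : k = 0 ∨ k = j
    · rw [if_pos h, if_neg (by tauto), abs_zero]
    · rw [if_neg h, if_pos (by tauto), abs_div, abs_pow]
  rw [hdrop]
  have hmem : ∀ k ∈ S₀, k ≠ 0 ∧ k ≠ j ∧ k ∈ S := fun k hk ↦ by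
    rw [hS₀, mem_filter] at hk
    exact ⟨hk.2.1, hk.2.2, hk.1⟩
  rw [← sum_filter_add_sum_filter_not S₀ (fun k ↦ 2 * |j - k| < |j|)]
  refine add_le_add ?_ ?_
  · -- near range: `|ψ k − ψ j|/|j − k|³ ≤ Dj/(j − k)²`
    set g : ℤ → ℝ := fun k ↦ Dj / ((j : ℝ) - k) ^ 2 with hg
    have hg0 : ∀ k, 0 ≤ g k := fun k ↦ by positivity
    calc ∑ k ∈ S₀.filter (fun k ↦ 2 * |j - k| < |j|), |ψ k - ψ j| / |(j : ℝ) - k| ^ 3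
        ≤ ∑ k ∈ S₀.filter (fun k ↦ 2 * |j - k| < |j|), g k := by
          refine sum_le_sum fun k hk ↦ ?_
          rw [mem_filter] at hk
          obtain ⟨hk0, hkj, -⟩ := hmem k hk.1
          have hm0 : (0 : ℝ) < |(j : ℝ) - k| := abs_pos.2 (sub_ne_zero.2 (by exact_mod_cast hkj.symm))
          simp only [hg]
          have hsq : ((j : ℝ) - k) ^ 2 = |(j : ℝ) - k| ^ 2 := (sq_abs _).symm
          rw [hsq, div_le_div_iff₀ (pow_pos hm0 3) (pow_pos hm0 2)]
          have h := hLip k hk0 hkj hk.2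
          rw [abs_sub_comm ((k : ℝ))] at h
          calc |ψ k - ψ j| * |(j : ℝ) - k| ^ 2 ≤ (Dj * |(j : ℝ) - k|) * |(j : ℝ) - k| ^ 2 :=
                mul_le_mul_of_nonneg_right h (by positivity)
            _ = Dj * |(j : ℝ) - k| ^ 3 := by ring
      _ ≤ ∑ m ∈ Icc 1 N, (g (j + m) + g (j - m)) := by
          refine sum_le_sum_Icc_shift _ j g hg0 fun k hk ↦ ?_
          obtain ⟨-, hkj, hkS⟩ := hmem k (mem_filter.1 hk).1
          exact ⟨by exact_mod_cast Int.one_le_abs (sub_ne_zero.2 hkj), by exact_mod_cast hN k hkS⟩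
      _ = ∑ m ∈ Icc 1 N, (2 * Dj) * (1 / (m : ℝ) ^ 2) := by
          refine sum_congr rfl fun m hm ↦ ?_
          have e1 : ((j : ℝ) - ((j + (m : ℤ) : ℤ) : ℝ)) ^ 2 = (m : ℝ) ^ 2 := by
            push_cast
            ring
          have e2 : ((j : ℝ) - ((j - (m : ℤ) : ℤ) : ℝ)) ^ 2 = (m : ℝ) ^ 2 := by
            push_cast
            ring
          simp only [hg]
          rw [e1, e2]
          ring
      _ = (2 * Dj) * ∑ m ∈ Icc 1 N, 1 / (m : ℝ) ^ 2 := by rw [mul_sum]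
      _ ≤ (2 * Dj) * 2 := by
          gcongr
          exact sum_Icc_inv_sq_le_two N
      _ = 4 * Dj := by ring
  · -- far range: `|ψ k − ψ j|/|j − k|³ ≤ 1/|j − k|³`
    set g : ℤ → ℝ := fun k ↦ 1 / |(j : ℝ) - k| ^ 3 with hg
    have hg0 : ∀ k, 0 ≤ g k := fun k ↦ by positivity
    set M : ℕ := (j.natAbs + 1) / 2 with hM_def
    have hM1 : 1 ≤ M := by
      have : 1 ≤ j.natAbs := Int.natAbs_pos.2 hj
      omega
    have hM2 : j.natAbs ≤ 2 * M := by omega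
    have hMR : |(j : ℝ)| ≤ 2 * (M : ℝ) := by
      have e : ((j.natAbs : ℕ) : ℝ) = |(j : ℝ)| := by rw [Nat.cast_natAbs, Int.cast_abs]
      rw [← e]
      exact_mod_cast hM2
    have hMR0 : (0 : ℝ) < M := by exact_mod_cast hM1
    have hjabs : ((j.natAbs : ℕ) : ℤ) = |j| := Int.natCast_natAbs j
    calc ∑ k ∈ S₀.filter (fun k ↦ ¬ 2 * |j - k| < |j|), |ψ k - ψ j| / |(j : ℝ) - k| ^ 3
        ≤ ∑ k ∈ S₀.filter (fun k ↦ ¬ 2 * |j - k| < |j|), g k := by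
          refine sum_le_sum fun k hk ↦ ?_
          simp only [hg]
          exact div_le_div_of_nonneg_right (hψd k) (by positivity)
      _ ≤ ∑ m ∈ Icc M N, (g (j + m) + g (j - m)) := by
          refine sum_le_sum_Icc_shift _ j g hg0 fun k hk ↦ ?_
          obtain ⟨hkS₀, hfark⟩ := mem_filter.1 hk
          obtain ⟨-, hkj, hkS⟩ := hmem k hkS₀
          rw [not_lt] at hfark
          have h1 : j - k ≤ |j - k| := le_abs_self _
          have h2 : -(j - k) ≤ |j - k| := neg_le_abs _
          have h3 : j ≤ |j| := le_abs_self _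
          have h4 : -j ≤ |j| := neg_le_abs _
          rw [abs_sub_comm] at hfark
          refine ⟨?_, by exact_mod_cast hN k hkS⟩
          push_cast [hM_def]
          omega
      _ = ∑ m ∈ Icc M N, 2 * (1 / (m : ℝ) ^ 3) := by
          refine sum_congr rfl fun m hm ↦ ?_
          have hm0 : (0 : ℝ) ≤ (m : ℝ) := Nat.cast_nonneg m
          have e1 : |(j : ℝ) - ((j + (m : ℤ) : ℤ) : ℝ)| = m := by
            push_cast
            rw [show (j : ℝ) - (j + m) = -(m : ℝ) by ring, abs_neg, abs_of_nonneg hm0]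
          have e2 : |(j : ℝ) - ((j - (m : ℤ) : ℤ) : ℝ)| = m := by
            push_cast
            rw [show (j : ℝ) - (j - m) = (m : ℝ) by ring, abs_of_nonneg hm0]
          simp only [hg]
          rw [e1, e2]
          ring
      _ = 2 * ∑ m ∈ Icc M N, 1 / (m : ℝ) ^ 3 := by rw [mul_sum]
      _ ≤ 2 * (2 / (M : ℝ) ^ 2) := by
          gcongr
          exact sum_Icc_inv_cube_le hM1 N
      _ ≤ 2 * (8 / (j : ℝ) ^ 2) := by
          gcongr 2 * ?_
          rw [div_le_div_iff₀ (by positivity) (by positivity)]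
          have : (j : ℝ) ^ 2 = |(j : ℝ)| ^ 2 := (sq_abs _).symm
          rw [this]
          nlinarith [hMR, hjR]
      _ = 16 / (j : ℝ) ^ 2 := by ring

/-- LATTICE PIECE, oddness: for `j ∈ ℤ`, the family `k ↦ (j − k)⁻³` (`k ≠ j`) is summable over
`ℤ` with sum `0` («`k ↦ 1/(k − j)` is odd around `j`», p. 43), by the reflection `k ↦ 2j − k`.
[cite: RodgersTaoFMP2020, §7 proof of Lemma 18, p. 43 («using the fact that k ↦ 1/(k−j) is odd around j»)] -/
theorem hasSum_inv_cube_sub (j : ℤ) :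
    HasSum (fun k : ℤ ↦ if k = j then (0 : ℝ) else 1 / ((j : ℝ) - k) ^ 3) 0 := by
  classical
  set O : ℤ → ℝ := fun k ↦ if k = j then (0 : ℝ) else 1 / ((j : ℝ) - k) ^ 3 with hO
  -- summability from uniform finite-sum bounds
  have habs : ∀ S : Finset ℤ, ∑ k ∈ S, |O k| ≤ 4 := fun S ↦ by
    obtain ⟨N, hN⟩ := exists_abs_sub_le S j
    set g : ℤ → ℝ := fun k ↦ if k = j then (0 : ℝ) else 1 / |(j : ℝ) - k| ^ 3 with hg
    have hg0 : ∀ k, 0 ≤ g k := fun k ↦ by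
      simp only [hg]
      split_ifs
      · exact le_rfl
      · positivity
    have hOg : ∀ k, |O k| = g k := fun k ↦ by
      simp only [hO, hg]
      split_ifs
      · exact abs_zero
      · rw [abs_div, abs_one, abs_pow]
    calc ∑ k ∈ S, |O k| = ∑ k ∈ S.filter (fun k ↦ k ≠ j), g k := by
          rw [sum_filter]
          refine sum_congr rfl fun k _ ↦ ?_
          rw [hOg]
          by_cases h : k = j
          · rw [if_neg (not_not.2 h)]
            simp [hg, h]
          · rw [if_pos h]
      _ ≤ ∑ m ∈ Icc 1 N, (g (j + m) + g (j - m)) := by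
          refine sum_le_sum_Icc_shift _ j g hg0 fun k hk ↦ ?_
          rw [mem_filter] at hk
          exact ⟨by exact_mod_cast Int.one_le_abs (sub_ne_zero.2 hk.2), by exact_mod_cast hN k hk.1⟩
      _ = ∑ m ∈ Icc 1 N, 2 * (1 / (m : ℝ) ^ 3) := by
          refine sum_congr rfl fun m hm ↦ ?_
          have hm1 : 1 ≤ m := (mem_Icc.1 hm).1
          have hm0 : (0 : ℝ) ≤ (m : ℝ) := Nat.cast_nonneg m
          have hne1 : j + (m : ℤ) ≠ j := by omega
          have hne2 : j - (m : ℤ) ≠ j := by omega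
          have e1 : |(j : ℝ) - ((j + (m : ℤ) : ℤ) : ℝ)| = m := by
            push_cast
            rw [show (j : ℝ) - (j + m) = -(m : ℝ) by ring, abs_neg, abs_of_nonneg hm0]
          have e2 : |(j : ℝ) - ((j - (m : ℤ) : ℤ) : ℝ)| = m := by
            push_cast
            rw [show (j : ℝ) - (j - m) = (m : ℝ) by ring, abs_of_nonneg hm0]
          simp only [hg, if_neg hne1, if_neg hne2]
          rw [e1, e2]
          ring
      _ = 2 * ∑ m ∈ Icc 1 N, 1 / (m : ℝ) ^ 3 := by rw [mul_sum]
      _ ≤ 2 * (2 / ((1 : ℕ) : ℝ) ^ 2) := by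
          gcongr
          exact sum_Icc_inv_cube_le le_rfl N
      _ = 4 := by norm_num
  have hsumAbs : Summable (fun k ↦ |O k|) := summable_of_sum_le (fun k ↦ abs_nonneg _) habs
  have hsum : Summable O := hsumAbs.of_abs
  -- oddness under `k ↦ 2j − k`
  have hrefl : ∀ k : ℤ, O (Equiv.subLeft (2 * j) k) = -O k := fun k ↦ by
    simp only [hO, Equiv.subLeft_apply]
    by_cases h : k = j
    · rw [if_pos h, if_pos (by rw [h]; ring), neg_zero]
    · have h' : 2 * j - k ≠ j := by omega
      rw [if_neg h', if_neg h]
      have hne : ((j : ℝ) - k) ≠ 0 := sub_ne_zero.2 (by exact_mod_cast (Ne.symm h))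
      push_cast
      rw [show (j : ℝ) - (2 * j - k) = -((j : ℝ) - k) by ring]
      rw [show (-((j : ℝ) - k)) ^ 3 = -(((j : ℝ) - k) ^ 3) by ring, div_neg]
  have htsum : ∑' k, O k = 0 := by
    have h1 : ∑' k, O (Equiv.subLeft (2 * j) k) = ∑' k, O k := Equiv.tsum_eq _ _
    have h2 : ∑' k, O (Equiv.subLeft (2 * j) k) = -∑' k, O k := by
      rw [← tsum_neg]
      exact tsum_congr hrefl
    linarith
  rw [← htsum]
  exact hsum.hasSum

/-- LATTICE PIECE on `ℤ* ∖ {j}`: removing the index `0` costs the single term `1/j³`: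
`Σ_{k ∈ ℤ*, k ≠ j} (j − k)⁻³ = −1/j³` (`j ∈ ℤ*`). [cite: RodgersTaoFMP2020, §7 proof of Lemma 18, p. 43] -/
theorem hasSum_inv_cube_sub_zstar {j : ℤ} (hj : j ≠ 0) :
    HasSum (fun k : ℤ ↦ if k = 0 ∨ k = j then (0 : ℝ) else 1 / ((j : ℝ) - k) ^ 3)
      (-(1 / (j : ℝ) ^ 3)) := by
  classical
  have h := hasSum_inv_cube_sub j
  have hsingle : HasSum (fun k : ℤ ↦ if k = 0 then 1 / (j : ℝ) ^ 3 else 0) (1 / (j : ℝ) ^ 3) :=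
    hasSum_ite_eq 0 _
  have hsub := h.sub hsingle
  have heq : (fun k : ℤ ↦ if k = 0 ∨ k = j then (0 : ℝ) else 1 / ((j : ℝ) - k) ^ 3) =
      fun k : ℤ ↦ (if k = j then (0 : ℝ) else 1 / ((j : ℝ) - k) ^ 3) -
        (if k = 0 then 1 / (j : ℝ) ^ 3 else 0) := by
    funext k
    by_cases hk0 : k = 0
    · have h0j : (0 : ℤ) ≠ j := fun h ↦ hj h.symm
      rw [hk0, if_pos (Or.inl rfl), if_neg h0j, if_pos rfl, Int.cast_zero, sub_zero, sub_self]
    · by_cases hkj : k = j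
      · rw [if_pos (Or.inr hkj), if_pos hkj, if_neg hk0, sub_zero]
      · rw [if_neg (by tauto), if_neg hkj, if_neg hk0, sub_zero]
  rw [heq, show (-(1 / (j : ℝ) ^ 3)) = 0 - 1 / (j : ℝ) ^ 3 by ring]
  exact hsub


/-- FAR-RANGE COMPARISON with the logarithm made explicit: for `|j| ≤ 2|j − k|` (so
`|k| ≤ 3|j − k|`), the crude lattice comparison of the Lemma 16 file with
`L = log(2 + 5B) + log|j − k|` and `(A + log m)³ ≤ (A + 3)³ m` gives
`|(ξ_j − ξ_k)⁻³ − (ℓ_j/4π)³(j − k)⁻³| ≤ (2(log(2 + 5B) + 3)³/c³)/(j − k)²`.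
[cite: RodgersTaoFMP2020, §7 proof of Lemma 18, p. 43 («we see from (44) that the contribution of those k with |k − j| ≥ j/2 is acceptable»)] -/
theorem far_comparison {c B : ℝ} (hc : 0 < c) (hc1 : c ≤ 1) (hB0 : 0 < B)
    (h44 : ∀ j k : ℤ, j ≠ 0 → k ≠ 0 →
      c * (|(k : ℝ) - j| / logPlus (|classicalLocationZ j| + |classicalLocationZ k|)) ≤
        |classicalLocationZ k - classicalLocationZ j|)
    (hB : ∀ k : ℤ, |classicalLocationZ k| ≤ B * |(k : ℝ)|)
    {j k : ℤ} (hj : j ≠ 0) (hk : k ≠ 0) (hkj : k ≠ j) (hfar : |j| ≤ 2 * |j - k|) :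
    |1 / (classicalLocationZ j - classicalLocationZ k) ^ 3 -
        (Real.log (classicalLocation (j.natAbs : ℝ) / (4 * π)) / (4 * π)) ^ 3 /
          ((j : ℝ) - k) ^ 3| ≤
      (2 * (Real.log (2 + 5 * B) + 3) ^ 3 / c ^ 3) / ((j : ℝ) - k) ^ 2 := by
  set A₁ : ℝ := Real.log (2 + 5 * B) with hA₁_def
  have hA₁ : 0 ≤ A₁ := Real.log_nonneg (by linarith)
  have hnat1 : (1 : ℝ) ≤ (j.natAbs : ℝ) := by
    have : 1 ≤ j.natAbs := Int.natAbs_pos.2 hj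
    exact_mod_cast this
  set ℓ : ℝ := Real.log (classicalLocation (j.natAbs : ℝ) / (4 * π)) with hℓ_def
  have hξpos : 0 < classicalLocation (j.natAbs : ℝ) := classicalLocation_pos (by linarith)
  have hξB : classicalLocation (j.natAbs : ℝ) ≤ B * |(j : ℝ)| := by
    rw [← RodgersTaoRenormEnergy.abs_classicalLocationZ hj]
    exact hB j
  -- integer bookkeeping: `1 ≤ |j − k|`, `|k| ≤ 3|j − k|`
  have hm1 : (1 : ℤ) ≤ |j - k| := Int.one_le_abs (sub_ne_zero.2 (Ne.symm hkj))
  have hk3 : |k| ≤ 3 * |j - k| := by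
    have := abs_sub_abs_le_abs_sub k j
    rw [abs_sub_comm k j] at this
    omega
  set m : ℝ := |(j : ℝ) - k| with hm_def
  have hmZ : ((|j - k| : ℤ) : ℝ) = m := by rw [hm_def, Int.cast_abs, Int.cast_sub]
  have hm1R : (1 : ℝ) ≤ m := by rw [← hmZ]; exact_mod_cast hm1
  have hm0 : 0 < m := by linarith
  have hjm : |(j : ℝ)| ≤ 2 * m := by
    rw [← hmZ, ← Int.cast_abs]; exact_mod_cast hfar
  have hkm : |(k : ℝ)| ≤ 3 * m := by
    rw [← hmZ, ← Int.cast_abs]; exact_mod_cast hk3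
  -- the master logarithm on this pair
  set L : ℝ := A₁ + Real.log m with hL_def
  have hsum : |classicalLocationZ k| + |classicalLocationZ j| ≤ 5 * B * m := by
    have h1 := hB k
    have h2 := hB j
    have e1 : B * |(k : ℝ)| ≤ B * (3 * m) := mul_le_mul_of_nonneg_left hkm hB0.le
    have e2 : B * |(j : ℝ)| ≤ B * (2 * m) := mul_le_mul_of_nonneg_left hjm hB0.le
    linarith
  have hle5 : 2 + (|classicalLocationZ k| + |classicalLocationZ j|) ≤ (2 + 5 * B) * m := by
    have h2m : (2 : ℝ) ≤ 2 * m := by linarith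
    calc 2 + (|classicalLocationZ k| + |classicalLocationZ j|) ≤ 2 * m + 5 * B * m := by linarith
      _ = (2 + 5 * B) * m := by ring
  have hnn : 0 ≤ |classicalLocationZ k| + |classicalLocationZ j| := by positivity
  have hΛL : logPlus (|classicalLocationZ k| + |classicalLocationZ j|) ≤ L := by
    rw [logPlus_eq, abs_of_nonneg hnn, hL_def, hA₁_def, ← Real.log_mul (by positivity) hm0.ne']
    exact Real.log_le_log (by positivity) hle5
  have hℓL : ℓ ≤ L := by
    have hle2 : B * |(j : ℝ)| ≤ (2 + 5 * B) * m := by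
      have e2 : B * |(j : ℝ)| ≤ B * (2 * m) := mul_le_mul_of_nonneg_left hjm hB0.le
      nlinarith
    calc ℓ ≤ Real.log (classicalLocation (j.natAbs : ℝ)) :=
          RodgersTao2020.log_classicalLocation_div_le hnat1
      _ ≤ Real.log ((2 + 5 * B) * m) := Real.log_le_log hξpos (hξB.trans hle2)
      _ = L := by rw [hL_def, hA₁_def, Real.log_mul (by positivity) hm0.ne']
  have hcrude := RodgersTaoRenormEnergy.lattice_comparison_crude hc hc1 h44 hj hk hkj hΛL hℓL
  -- `2L³/(c³m³) ≤ D/m²`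
  have hL3 : L ^ 3 ≤ (A₁ + 3) ^ 3 * m := add_log_pow_three_le hA₁ hm1R
  have hmsq : ((j : ℝ) - k) ^ 2 = m ^ 2 := by rw [hm_def, sq_abs]
  refine hcrude.trans ?_
  rw [hmsq, div_div, div_le_div_iff₀ (by positivity) (by positivity)]
  calc 2 * L ^ 3 * (c ^ 3 * m ^ 2) ≤ 2 * ((A₁ + 3) ^ 3 * m) * (c ^ 3 * m ^ 2) := by
        gcongr
    _ = 2 * (A₁ + 3) ^ 3 * (c ^ 3 * m ^ 3) := by ring

/-- The final bookkeeping of the weighted inner sum (pure real arithmetic): the three pieces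
(error `≤ 4K₄ℓ²/|j| + 8D/|j|`, lattice `≤ L3/|j|³`, oscillation `≤ L3(4·200/(2N + |j|) + 16/j²)`)
against `log³ T·(1/|j| + 1/T)`, using the absorptions `ℓ^p ≤ C_p log^p T (1 + |j|/T)`.
[cite: RodgersTaoFMP2020, §7 proof of Lemma 18, p. 43 («the claim follows by direct computation»)] -/
theorem final_bookkeeping {T N a ℓ L3 K₄ D C₂ C₃ E Ot Wt : ℝ} (hT0 : 0 < T)
    (hlogT : 1 ≤ Real.log T) (hTN : T ≤ N) (ha : 1 ≤ a) (hℓ0 : 0 ≤ ℓ) (hL3 : 0 ≤ L3)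
    (hL3le : L3 ≤ ℓ ^ 3) (hK₄ : 0 ≤ K₄) (hD : 0 ≤ D) (hC₂ : 0 ≤ C₂) (hC₃ : 0 ≤ C₃)
    (habs3 : ℓ ^ 3 ≤ C₃ * Real.log T ^ 3 * (1 + a / T))
    (habs2 : ℓ ^ 2 ≤ C₂ * Real.log T ^ 2 * (1 + a / T))
    (hE : |E| ≤ 4 * K₄ * ℓ ^ 2 / a + 8 * D / a) (hOt : |Ot| ≤ 1 / a ^ 3)
    (hW : |Wt| ≤ 4 * (200 / (2 * N + a)) + 16 / a ^ 2) :
    |E + L3 * (Ot + Wt)| ≤ (1617 * C₃ + 4 * K₄ * C₂ + 8 * D) * Real.log T ^ 3 * (1 / a + 1 / T) := by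
  have ha0 : 0 < a := by linarith
  have hN : 0 < N := hT0.trans_le hTN
  set Φ : ℝ := Real.log T ^ 3 * (1 / a + 1 / T) with hΦ_def
  have hlog3 : 1 ≤ Real.log T ^ 3 := one_le_pow₀ hlogT
  have hΦ0 : 0 ≤ Φ := by positivity
  have hkey : (1 + a / T) / a = 1 / a + 1 / T := by
    field_simp
  have hl3j : ℓ ^ 3 / a ≤ C₃ * Φ := by
    calc ℓ ^ 3 / a ≤ C₃ * Real.log T ^ 3 * (1 + a / T) / a :=
          div_le_div_of_nonneg_right habs3 ha0.le
      _ = C₃ * Φ := by rw [hΦ_def, ← hkey]; ring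
  -- (i) lattice term
  have hi : L3 * |Ot| ≤ C₃ * Φ := by
    have h2 : 1 / a ^ 3 ≤ 1 / a := by
      apply div_le_div_of_nonneg_left zero_le_one ha0
      nlinarith
    calc L3 * |Ot| ≤ ℓ ^ 3 * (1 / a) := mul_le_mul hL3le (hOt.trans h2) (abs_nonneg _) (pow_nonneg hℓ0 3)
      _ = ℓ ^ 3 / a := by ring
      _ ≤ C₃ * Φ := hl3j
  -- (ii) far oscillation
  have hii : L3 * (16 / a ^ 2) ≤ 16 * C₃ * Φ := by
    have h2 : 16 / a ^ 2 ≤ 16 / a := by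
      apply div_le_div_of_nonneg_left (by norm_num) ha0
      nlinarith
    calc L3 * (16 / a ^ 2) ≤ ℓ ^ 3 * (16 / a) := mul_le_mul hL3le h2 (by positivity) (pow_nonneg hℓ0 3)
      _ = 16 * (ℓ ^ 3 / a) := by ring
      _ ≤ 16 * (C₃ * Φ) := by gcongr
      _ = 16 * C₃ * Φ := by ring
  -- (iii) near oscillation
  have hiii : L3 * (4 * (200 / (2 * N + a))) ≤ 1600 * C₃ * Φ := by
    have hden : 0 < 2 * N + a := by positivity
    have h2 : (1 + a / T) / (2 * N + a) ≤ 2 / T := by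
      rw [div_le_div_iff₀ hden hT0]
      have : (1 + a / T) * T = T + a := by field_simp
      rw [this]
      nlinarith
    calc L3 * (4 * (200 / (2 * N + a))) ≤ ℓ ^ 3 * (4 * (200 / (2 * N + a))) :=
          mul_le_mul_of_nonneg_right hL3le (by positivity)
      _ = 800 * (ℓ ^ 3 / (2 * N + a)) := by ring
      _ ≤ 800 * (C₃ * Real.log T ^ 3 * (1 + a / T) / (2 * N + a)) := by gcongr
      _ = 800 * (C₃ * Real.log T ^ 3) * ((1 + a / T) / (2 * N + a)) := by ring
      _ ≤ 800 * (C₃ * Real.log T ^ 3) * (2 / T) := by gcongr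
      _ ≤ 800 * (C₃ * Real.log T ^ 3) * (2 * (1 / a + 1 / T)) := by
          gcongr
          have : 0 ≤ 1 / a := by positivity
          have e : 2 / T = 2 * (1 / T) := by ring
          linarith
      _ = 1600 * C₃ * Φ := by rw [hΦ_def]; ring
  -- (iv) near error
  have hiv : 4 * K₄ * ℓ ^ 2 / a ≤ 4 * K₄ * C₂ * Φ := by
    have h1 : ℓ ^ 2 / a ≤ C₂ * Real.log T ^ 2 * (1 / a + 1 / T) := by
      calc ℓ ^ 2 / a ≤ C₂ * Real.log T ^ 2 * (1 + a / T) / a := div_le_div_of_nonneg_right habs2 ha0.le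
        _ = C₂ * Real.log T ^ 2 * (1 / a + 1 / T) := by rw [← hkey]; ring
    have h2 : Real.log T ^ 2 ≤ Real.log T ^ 3 := by
      rw [pow_succ]
      exact le_mul_of_one_le_right (by positivity) hlogT
    calc 4 * K₄ * ℓ ^ 2 / a = 4 * K₄ * (ℓ ^ 2 / a) := by ring
      _ ≤ 4 * K₄ * (C₂ * Real.log T ^ 2 * (1 / a + 1 / T)) := by gcongr
      _ ≤ 4 * K₄ * (C₂ * Real.log T ^ 3 * (1 / a + 1 / T)) := by gcongr
      _ = 4 * K₄ * C₂ * Φ := by rw [hΦ_def]; ring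
  -- (v) far error
  have hv : 8 * D / a ≤ 8 * D * Φ := by
    calc 8 * D / a = 8 * D * (1 / a) := by ring
      _ ≤ 8 * D * (1 / a + 1 / T) := by
          gcongr
          exact le_add_of_nonneg_right (by positivity)
      _ ≤ 8 * D * (Real.log T ^ 3 * (1 / a + 1 / T)) := by
          gcongr
          exact le_mul_of_one_le_left (by positivity) hlog3
      _ = 8 * D * Φ := by rw [hΦ_def]
  calc |E + L3 * (Ot + Wt)| ≤ |E| + |L3 * (Ot + Wt)| := abs_add_le _ _
    _ ≤ |E| + L3 * (|Ot| + |Wt|) := by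
        rw [abs_mul, abs_of_nonneg hL3]
        gcongr
        exact abs_add_le _ _
    _ ≤ (4 * K₄ * ℓ ^ 2 / a + 8 * D / a) + L3 * (|Ot| + (4 * (200 / (2 * N + a)) + 16 / a ^ 2)) := by
        gcongr
    _ = 4 * K₄ * ℓ ^ 2 / a + 8 * D / a +
          (L3 * |Ot| + L3 * (4 * (200 / (2 * N + a))) + L3 * (16 / a ^ 2)) := by ring
    _ ≤ 4 * K₄ * C₂ * Φ + 8 * D * Φ + (C₃ * Φ + 1600 * C₃ * Φ + 16 * C₃ * Φ) := by
        gcongr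
    _ = (1617 * C₃ + 4 * K₄ * C₂ + 8 * D) * Real.log T ^ 3 * (1 / a + 1 / T) := by
        rw [hΦ_def]; ring

end RodgersTaoTruncEnergy

namespace RodgersTao2020

open RodgersTaoTruncEnergy RodgersTaoRenormEnergy

set_option maxHeartbeats 400000 in
/-- RH-FREE, CONTENT, `t`-FREE — Rodgers–Tao 2020, §7, proof of Lemma 18 (= arXiv v4 Lemma 7.3),
the reduced display (FMP p. 43, third display): «it will suffice to establish the bound
`Σ_{k ∈ ℤ* : k ≠ j} ψ_T(k)/(ξ_k − ξ_j)³ ≲ 1/|j| + 1/T` for all `j ∈ ℤ*`» (`≲` = `≪ log^{O(1)} T`,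
`T` large), a statement about the classical locations `ξ_j` and the weight `ψ_T` of (66) only.
Rendered with the explicit threshold `T ≥ 3` and exponent `3`: one absolute `C` such that for all
`T ≥ 3` and `j ∈ ℤ*`, the family `k ↦ ψ_T(k)/(ξ_k − ξ_j)³` (`k ∈ ℤ* ∖ {j}`, extended by `0`) is
summable over `ℤ` and `|Σ'_k ψ_T(k)/(ξ_k − ξ_j)³| ≤ C log³ T · (1/|j| + 1/T)`. Proof as printed
(«As in the proof of Lemma 16»: (44) on `|k − j| ≥ |j|/2`, (45) on the near range — via the
landed comparisons `RodgersTaoRenormEnergy.lattice_comparison_crude/fine` —,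
«`ψ_T(k) = ψ_T(j) + Õ(|k − j|/T)`» = `abs_truncWeight_sub_le_of_near`, and «`k ↦ 1/(k − j)` is
odd around `j`» = `hasSum_inv_cube_sub_zstar`, exact over `ℤ* ∖ {j}` up to the single term
`1/j³`), the powers of `log₊|j|` being absorbed into `log³ T·(1/|j| + 1/T)` (split at `|j| = T²`).
[cite: RodgersTaoFMP2020, §7 proof of Lemma 18, p. 43 (= arXiv:1801.05914v4 Lemma 7.3)] -/
theorem tsum_truncWeight_div_cube_classicalLocationZ_le :
    ∃ C : ℝ, 0 ≤ C ∧ ∀ T : ℝ, 3 ≤ T → ∀ j : ℤ, j ≠ 0 →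
      Summable (fun k : ℤ ↦ if k = 0 ∨ k = j then (0 : ℝ) else
          truncWeight T k / (classicalLocationZ k - classicalLocationZ j) ^ 3) ∧
        |∑' k : ℤ, (if k = 0 ∨ k = j then (0 : ℝ) else
            truncWeight T k / (classicalLocationZ k - classicalLocationZ j) ^ 3)| ≤
          C * Real.log T ^ 3 * (1 / |(j : ℝ)| + 1 / T) := by
  classical
  -- constants of Lemma 8, normalised as in the Lemma 16 file
  obtain ⟨c₀, C₁, hc₀, hc₀C, h44₀⟩ := lemma31_ii_holds_record
  obtain ⟨A₀, h45₀⟩ := lemma31_iii_holds 2 (by norm_num)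
  obtain ⟨B₀, -, hB₀⟩ := exists_abs_classicalLocationZ_le
  set c : ℝ := min c₀ 1 with hc_def
  have hc : 0 < c := lt_min hc₀ one_pos
  have hc1 : c ≤ 1 := min_le_right _ _
  have hcC : c ≤ C₁ := (min_le_left _ _).trans hc₀C
  have h44 : ∀ j k : ℤ, j ≠ 0 → k ≠ 0 →
      c * (|(k : ℝ) - j| / _root_.Literature.NumberTheory.LFunctions.logPlus
          (|classicalLocationZ j| + |classicalLocationZ k|)) ≤
          |classicalLocationZ k - classicalLocationZ j| ∧
        |classicalLocationZ k - classicalLocationZ j| ≤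
          C₁ * (|(k : ℝ) - j| / _root_.Literature.NumberTheory.LFunctions.logPlus
            (|classicalLocationZ j| + |classicalLocationZ k|)) := fun j k hj hk ↦
    ⟨(mul_le_mul_of_nonneg_right (min_le_left _ _)
      (div_nonneg (abs_nonneg _) (logPlus_nonneg _))).trans (h44₀ j k hj hk).1,
      (h44₀ j k hj hk).2⟩
  set A : ℝ := max A₀ 0 with hA_def
  have hA : 0 ≤ A := le_max_right _ _
  have h45 : ∀ j k : ℝ, 1 ≤ j → 1 ≤ k → j ≤ 2 * k → k ≤ 2 * j →
      |classicalLocation k - classicalLocation j -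
          4 * π * (k - j) / Real.log (classicalLocation j / (4 * π))| ≤
        A * ((k - j) ^ 2 / (j * Real.log (classicalLocation j) ^ 2)) :=
    fun j k hj hk hjk hkj ↦ (h45₀ j k hj hk hjk hkj).trans
      (mul_le_mul_of_nonneg_right (le_max_left _ _)
        (div_nonneg (sq_nonneg _) (mul_nonneg (by linarith) (sq_nonneg _))))
  set B : ℝ := max B₀ 1 with hB_def
  have hB1 : 1 ≤ B := le_max_right _ _
  have hB0 : 0 < B := zero_lt_one.trans_le hB1
  have hB : ∀ k : ℤ, |classicalLocationZ k| ≤ B * |(k : ℝ)| := fun k ↦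
    (hB₀ k).trans (mul_le_mul_of_nonneg_right (le_max_left _ _) (abs_nonneg _))
  have hlog3B : 0 ≤ Real.log (2 + 3 * B) := Real.log_nonneg (by linarith)
  set K₄ : ℝ := 3 * A * max C₁ (4 * π) ^ 2 * (Real.log (2 + 3 * B) + 8) ^ 3 /
    ((4 * π) ^ 3 * c ^ 3) with hK₄_def
  have hK₄ : 0 ≤ K₄ :=
    div_nonneg (mul_nonneg (mul_nonneg (mul_nonneg (by norm_num) hA) (sq_nonneg _))
      (pow_nonneg (by linarith) 3)) (by positivity)
  set A₁ : ℝ := Real.log (2 + 5 * B) with hA₁_def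
  have hA₁ : 0 ≤ A₁ := Real.log_nonneg (by linarith)
  set D : ℝ := 2 * (A₁ + 3) ^ 3 / c ^ 3 with hD_def
  have hD : 0 ≤ D := by positivity
  set A₂ : ℝ := Real.log B with hA₂_def
  have hA₂ : 0 ≤ A₂ := Real.log_nonneg hB1
  set C₂ : ℝ := (A₂ + 2 * (2 : ℕ)) ^ (2 : ℕ) with hC₂_def
  set C₃ : ℝ := (A₂ + 2 * (3 : ℕ)) ^ (3 : ℕ) with hC₃_def
  have hC₂ : 0 ≤ C₂ := by positivity
  have hC₃ : 0 ≤ C₃ := by positivity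
  refine ⟨1617 * C₃ + 4 * K₄ * C₂ + 8 * D,
    add_nonneg (add_nonneg (mul_nonneg (by norm_num) hC₃)
      (mul_nonneg (mul_nonneg (by norm_num) hK₄) hC₂)) (mul_nonneg (by norm_num) hD),
    fun T hT j hj ↦ ?_⟩
  -- basic quantities at `T`, `j`
  have hT0 : 0 < T := by linarith
  have hlogT : 1 ≤ Real.log T := by
    rw [← Real.log_exp 1]
    refine Real.log_le_log (Real.exp_pos 1) ?_
    have := Real.exp_one_lt_d9
    linarith
  set N : ℝ := T * Real.log T with hN_def
  have hTN : T ≤ N := by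
    have : T * 1 ≤ T * Real.log T := mul_le_mul_of_nonneg_left hlogT hT0.le
    linarith
  have hN : 0 < N := hT0.trans_le hTN
  have hjR : (0 : ℝ) < |(j : ℝ)| := abs_pos.2 (by exact_mod_cast hj)
  have hj1 : (1 : ℝ) ≤ |(j : ℝ)| := by exact_mod_cast Int.one_le_abs hj
  set ψ : ℤ → ℝ := fun k ↦ truncWeight T k with hψ_def
  have hψ0 : ∀ k, 0 ≤ ψ k := fun k ↦ (truncWeight_pos hN k).le
  have hψ1 : ∀ k, ψ k ≤ 1 := fun k ↦ truncWeight_le_one hN k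
  have hnat1 : (1 : ℝ) ≤ (j.natAbs : ℝ) := by
    have : 1 ≤ j.natAbs := Int.natAbs_pos.2 hj
    exact_mod_cast this
  set ℓ : ℝ := Real.log (classicalLocation (j.natAbs : ℝ) / (4 * π)) with hℓ_def
  have hℓ1 : 1 < ℓ := one_lt_log_classicalLocation_div hnat1
  have hℓ0 : 0 ≤ ℓ := by linarith
  have hξpos : 0 < classicalLocation (j.natAbs : ℝ) := classicalLocation_pos (by linarith)
  have hξB : classicalLocation (j.natAbs : ℝ) ≤ B * |(j : ℝ)| := by
    rw [← abs_classicalLocationZ hj]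
    exact hB j
  have hℓ_le : ℓ ≤ A₂ + Real.log |(j : ℝ)| := by
    calc ℓ ≤ Real.log (classicalLocation (j.natAbs : ℝ)) := log_classicalLocation_div_le hnat1
      _ ≤ Real.log (B * |(j : ℝ)|) := Real.log_le_log hξpos hξB
      _ = A₂ + Real.log |(j : ℝ)| := by rw [hA₂_def, Real.log_mul hB0.ne' hjR.ne']
  have hAlog : 0 ≤ A₂ + Real.log |(j : ℝ)| := by
    have := Real.log_nonneg hj1
    linarith
  -- absorption of `ℓ²`, `ℓ³`
  have habs3 : ℓ ^ 3 ≤ C₃ * Real.log T ^ 3 * (1 + |(j : ℝ)| / T) := by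
    have h := add_log_pow_le hA₂ (p := 3) (by norm_num) hT hj1
    exact (pow_le_pow_left₀ hℓ0 hℓ_le 3).trans h
  have habs2 : ℓ ^ 2 ≤ C₂ * Real.log T ^ 2 * (1 + |(j : ℝ)| / T) := by
    have h := add_log_pow_le hA₂ (p := 2) (by norm_num) hT hj1
    exact (pow_le_pow_left₀ hℓ0 hℓ_le 2).trans h
  -- the lattice comparisons (centre `j`, running index `k`)
  set e : ℤ → ℝ := fun k ↦ 1 / (classicalLocationZ j - classicalLocationZ k) ^ 3 -
    (ℓ / (4 * π)) ^ 3 / ((j : ℝ) - k) ^ 3 with he_def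
  have hfine : ∀ k : ℤ, k ≠ 0 → k ≠ j → 2 * |j - k| < |j| →
      |e k| ≤ K₄ * (ℓ ^ 2 / (|(j : ℝ)| * ((j : ℝ) - k) ^ 2)) := fun k hk0 hkj hnear ↦
    lattice_comparison_fine hc hcC hA hB1 h44 h45 hB hj hkj hnear
  have hfar : ∀ k : ℤ, k ≠ 0 → k ≠ j → ¬ 2 * |j - k| < |j| →
      |e k| ≤ D / ((j : ℝ) - k) ^ 2 := fun k hk0 hkj hfark ↦
    far_comparison hc hc1 hB0 (fun j k hj hk ↦ (h44 j k hj hk).1) hB hj hk0 hkj (not_lt.1 hfark)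
  -- the Lipschitz bound for `ψ_T` on the near range
  set Dj : ℝ := 200 / (2 * N + |(j : ℝ)|) with hDj_def
  have hDj : 0 ≤ Dj := div_nonneg (by norm_num) (by linarith [abs_nonneg (j : ℝ)])
  have hLip : ∀ k : ℤ, k ≠ 0 → k ≠ j → 2 * |j - k| < |j| → |ψ k - ψ j| ≤ Dj * |(k : ℝ) - j| :=
    fun k _ _ hnear ↦ by
      have h := abs_truncWeight_sub_le_of_near hN hnear
      simp only [hψ_def, hDj_def]
      rw [div_mul_eq_mul_div, mul_comm (200 : ℝ)]
      rw [mul_comm (200 : ℝ)] at h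
      exact h
  -- the three pieces
  set Err : ℤ → ℝ := fun k ↦ if k = 0 ∨ k = j then (0 : ℝ) else ψ k * e k with hErr_def
  set W : ℤ → ℝ := fun k ↦ if k = 0 ∨ k = j then (0 : ℝ) else (ψ k - ψ j) / ((j : ℝ) - k) ^ 3
    with hW_def
  set O : ℤ → ℝ := fun k ↦ if k = 0 ∨ k = j then (0 : ℝ) else 1 / ((j : ℝ) - k) ^ 3 with hO_def
  have hErr_fin : ∀ S : Finset ℤ, ∑ k ∈ S, |Err k| ≤ 4 * K₄ * ℓ ^ 2 / |(j : ℝ)| + 8 * D / |(j : ℝ)| :=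
    sum_abs_weightedError_le hψ0 hψ1 hj hK₄ hD hfine hfar
  have hW_fin : ∀ S : Finset ℤ, ∑ k ∈ S, |W k| ≤ 4 * Dj + 16 / (j : ℝ) ^ 2 :=
    sum_abs_oscillation_le hψ0 hψ1 hj hDj hLip
  have hErrA : Summable (fun k ↦ |Err k|) := summable_of_sum_le (fun _ ↦ abs_nonneg _) hErr_fin
  have hWA : Summable (fun k ↦ |W k|) := summable_of_sum_le (fun _ ↦ abs_nonneg _) hW_fin
  have hErrS : Summable Err := hErrA.of_abs
  have hWS : Summable W := hWA.of_abs
  have hO : HasSum O (-(1 / (j : ℝ) ^ 3)) := hasSum_inv_cube_sub_zstar hj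
  have hErr_tsum : |∑' k, Err k| ≤ 4 * K₄ * ℓ ^ 2 / |(j : ℝ)| + 8 * D / |(j : ℝ)| := by
    have h1 := norm_tsum_le_tsum_norm (f := Err) (by simpa [Real.norm_eq_abs] using hErrA)
    simp only [Real.norm_eq_abs] at h1
    exact h1.trans (tsum_le_of_sum_le (fun _ ↦ abs_nonneg _) hErr_fin)
  have hW_tsum : |∑' k, W k| ≤ 4 * Dj + 16 / (j : ℝ) ^ 2 := by
    have h1 := norm_tsum_le_tsum_norm (f := W) (by simpa [Real.norm_eq_abs] using hWA)
    simp only [Real.norm_eq_abs] at h1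
    exact h1.trans (tsum_le_of_sum_le (fun _ ↦ abs_nonneg _) hW_fin)
  -- the pointwise decomposition
  set L3 : ℝ := (ℓ / (4 * π)) ^ 3 with hL3_def
  have hL3_0 : 0 ≤ L3 := pow_nonneg (div_nonneg hℓ0 (by linarith [Real.pi_gt_three])) 3
  have hident : (fun k : ℤ ↦ if k = 0 ∨ k = j then (0 : ℝ) else
      truncWeight T k / (classicalLocationZ k - classicalLocationZ j) ^ 3) =
      fun k ↦ -(Err k + L3 * (ψ j * O k + W k)) := by
    funext k
    by_cases h : k = 0 ∨ k = j
    · simp only [hErr_def, hO_def, hW_def, if_pos h]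
      ring
    · simp only [hErr_def, hO_def, hW_def, he_def, hψ_def, hL3_def, if_neg h]
      have hkj : k ≠ j := fun h' ↦ h (Or.inr h')
      have hflip : (classicalLocationZ k - classicalLocationZ j) ^ 3 =
          -((classicalLocationZ j - classicalLocationZ k) ^ 3) := by ring
      rw [hflip, div_neg]
      ring
  have hS : Summable (fun k ↦ -(Err k + L3 * (ψ j * O k + W k))) :=
    (hErrS.add (((hO.summable.mul_left (ψ j)).add hWS).mul_left L3)).neg
  refine ⟨by rw [hident]; exact hS, ?_⟩
  rw [hident, tsum_neg, abs_neg, hErrS.tsum_add (((hO.summable.mul_left (ψ j)).add hWS).mul_left L3),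
    tsum_mul_left, ((hO.summable.mul_left (ψ j))).tsum_add hWS, tsum_mul_left, hO.tsum_eq]
  -- assemble the bound (pure arithmetic, `final_bookkeeping`)
  have hL3le : L3 ≤ ℓ ^ 3 := by
    rw [hL3_def, div_pow]
    exact div_le_self (pow_nonneg hℓ0 3) (one_le_pow₀ (by linarith [Real.pi_gt_three]))
  have hOt : |ψ j * -(1 / (j : ℝ) ^ 3)| ≤ 1 / |(j : ℝ)| ^ 3 := by
    rw [abs_mul, abs_of_nonneg (hψ0 j), abs_neg, abs_div, abs_one, abs_pow]
    calc ψ j * (1 / |(j : ℝ)| ^ 3) ≤ 1 * (1 / |(j : ℝ)| ^ 3) :=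
          mul_le_mul_of_nonneg_right (hψ1 j) (by positivity)
      _ = 1 / |(j : ℝ)| ^ 3 := one_mul _
  have hW' : |∑' k, W k| ≤ 4 * (200 / (2 * N + |(j : ℝ)|)) + 16 / |(j : ℝ)| ^ 2 := by
    rw [sq_abs]
    exact hW_tsum
  exact final_bookkeeping hT0 hlogT hTN hj1 hℓ0 hL3_0 hL3le hK₄ hD hC₂ hC₃ habs3 habs2 hErr_tsum
    hOt hW'

end RodgersTao2020

end Literature.NumberTheory.LFunctions
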